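import Literature.Geometry.Riemannian.VolumeSphereTheoremProofs
import HarnessLib

/-!
# The Jacobian comparison of the ABP method (Brendle 2023, Prop. 2.5): `det P(t) ≤ (1 + tκ)ⁿ`

Topic `Geometry/Riemannian`. The matrix-ODE layer of S. Brendle's proof of the sharp Sobolev /
isoperimetric inequality on complete manifolds with `Ric ≥ 0` and Euclidean volume growth
(*Sobolev inequalities in manifolds with nonnegative curvature*, CPAM 76 (2023), §2, Prop. 2.5 and
Cor. 2.6). Along the geodesic `γ̄(t) = exp_x̄(t∇u(x̄))` of the ABP map `Φ_t(x) = exp_x(t ∇u(x))`, the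
matrix `P(t)` of the Jacobi fields `X_i` (`X_i(0) = e_i`, `⟨D_tX_i(0), e_j⟩ = D²u(e_i,e_j)`) in a
parallel orthonormal frame satisfies `P'' = −P S`, `S` symmetric with `tr S = Ric(γ̄',γ̄') ≥ 0`,
`P(0) = I`, `P'(0) = D²u(x̄)` symmetric, and `P(t)` is invertible for `t ∈ (0, r)` (no zeros of the
Jacobi fields, Lemma 2.4). Brendle shows: `P'Pᵀ` is symmetric, hence `Q = P⁻¹P'` is symmetric and
satisfies the Riccati equation `Q' = −S − Q²`, so `tr Q' ≤ −tr(Q)²/n`, `tr Q(0) = Δu(x̄) ≤ nκ`,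
whence `tr Q(t) ≤ nκ/(1 + tκ)`, `(log det P)' = tr Q`, and `t ↦ (1 + tκ)^{-n} det P(t)` is
non-increasing; in particular `|det DΦ_t(x̄)| = det P(t) ≤ (1 + tκ)ⁿ` (Cor. 2.6). We prove exactly
this statement about matrix curves, in the column convention of the tree's Jacobi-tensor layer
(`VolumeSphereTheoremProofs.lean`, §8: `𝒜'' + ℛ𝒜 = 0`, i.e. `𝒜 = Pᵀ`, `ℛ = S`, `det 𝒜 = det P`),
reusing its Wronskian / Riccati / Jacobi-formula lemmas:

* `jacobi_wronskian_eq_zero_of_isSymm` — `𝒜'ᵀ𝒜 = 𝒜ᵀ𝒜'` when `𝒜(0) = I` and `𝒜'(0)` is symmetric;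
* `trace_shape_le_of_hessian` — `tr 𝒜'𝒜⁻¹ ≤ nκ/(1 + tκ)` on `(0, r)` (scalar Riccati comparison);
* `det_jacobi_pos_of_isUnit` — `det 𝒜 > 0` on `[0, r)`;
* `antitoneOn_det_div_pow_of_hessian` — **Prop. 2.5**: `t ↦ det 𝒜(t)/(1 + tκ)ⁿ` is non-increasing
  on `[0, r)`;
* `det_le_pow_of_hessian` — **Cor. 2.6**: `det 𝒜(t) ≤ (1 + tκ)ⁿ` on `[0, r)`.

Pure matrix analysis (no Riemannian geometry); `n = Fintype.card ι`. Everything is proved; no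
definitions, no named facts. This is the first, self-contained brick of the geometric half of
Brendle's ABP argument (towards the sharp `L¹`-Sobolev inequality that
`Literature.Geometry.Riemannian.sharpLogSobolevAVR_four_of_l1Sobolev` consumes).

## References

* [Brendle2022] S. Brendle, *Sobolev inequalities in manifolds with nonnegative curvature*, Comm.
  Pure Appl. Math. 76 (2023) 2192–2218 (arXiv:2009.13717), §2: Prop. 2.5 and Cor. 2.6 (pp. 5–6 of
  the arXiv text). READ.
* I. Chavel, *Riemannian Geometry: A Modern Introduction*, 2nd ed. (2006), §III.4 (the Jacobi
  tensor formalism reused here).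
-/

noncomputable section

namespace Literature.Geometry.Riemannian

section ABPJacobian

open Set Filter Topology Matrix

open scoped Matrix.Norms.Operator

variable {ι : Type*} [Fintype ι] [DecidableEq ι]

/-- **The Wronskian vanishes for Hessian initial data**: if `𝒜'' + ℛ𝒜 = 0` on an interval around
`0` with `ℛ` self-adjoint, `𝒜(0) = I` and `𝒜'(0)` self-adjoint, then `𝒜'ᵀ𝒜 = 𝒜ᵀ𝒜'` there
(`W = 𝒜'ᵀ𝒜 − 𝒜ᵀ𝒜'` has `W' = 0` and `W(0) = 𝒜'(0)ᵀ − 𝒜'(0) = 0`). Brendle 2023, proof of Prop. 2.5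
("the matrix `P'(t)P(t)ᵀ` is symmetric for each `t`"). [cite: Brendle2022, Prop. 2.5 (proof)] -/
theorem jacobi_wronskian_eq_zero_of_isSymm {A A' R : ℝ → Matrix ι ι ℝ} {a b : ℝ}
    (h0 : (0 : ℝ) ∈ Ioo a b)
    (hA : ∀ t ∈ Ioo a b, HasDerivAt A (A' t) t)
    (hA' : ∀ t ∈ Ioo a b, HasDerivAt A' (-(R t * A t)) t)
    (hR : ∀ t ∈ Ioo a b, (R t).IsSymm) (hA0 : A 0 = 1) (hS0 : (A' 0).IsSymm) :
    ∀ t ∈ Ioo a b, (A' t)ᵀ * A t = (A t)ᵀ * A' t := by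
  set W : ℝ → Matrix ι ι ℝ := fun s ↦ (A' s)ᵀ * A s - (A s)ᵀ * A' s with hW_def
  have hW : ∀ s ∈ Ioo a b, HasDerivAt W (0 : Matrix ι ι ℝ) s := by
    intro s hs
    have h1 := (hasDerivAt_matrix_transpose (hA' s hs)).mul (hA s hs)
    have h2 := (hasDerivAt_matrix_transpose (hA s hs)).mul (hA' s hs)
    have h := h1.sub h2
    refine h.congr_deriv ?_
    rw [Matrix.transpose_neg, Matrix.transpose_mul, (hR s hs).eq]
    noncomm_ring
  intro t ht
  have key := (convex_Ioo a b).norm_image_sub_le_of_norm_hasDerivWithin_le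
    (fun s hs ↦ (hW s hs).hasDerivWithinAt) (fun s _ ↦ norm_zero.le) h0 ht
  rw [zero_mul, norm_le_zero_iff, sub_eq_zero] at key
  have hW0 : W 0 = 0 := by
    simp only [hW_def, hA0, Matrix.mul_one, Matrix.transpose_one, Matrix.one_mul]
    rw [hS0.eq, sub_self]
  have hWt : W t = 0 := by rw [key, hW0]
  exact sub_eq_zero.1 hWt

/-- **`det 𝒜 > 0` on `[0, r)`** when `𝒜` is continuous there, `𝒜(0) = I` and `𝒜(t)` is
invertible for `t ∈ [0, r)` (intermediate value theorem). Brendle 2023, proof of Prop. 2.5: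
"`det P(t) > 0` if `t` is sufficiently small. Since `P(t)` is invertible for each `t ∈ (0,r)`, it
follows that `det P(t) > 0`". [cite: Brendle2022, Prop. 2.5 (proof)] -/
theorem det_jacobi_pos_of_isUnit {A : ℝ → Matrix ι ι ℝ} {r : ℝ}
    (hAc : ContinuousOn A (Ico 0 r)) (hA0 : A 0 = 1)
    (hunit : ∀ t ∈ Ico 0 r, IsUnit (A t).det) :
    ∀ t ∈ Ico 0 r, 0 < (A t).det := by
  intro t ht
  by_contra hle
  push Not at hle
  have hdc : ContinuousOn (fun s ↦ (A s).det) (Icc 0 t) :=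
    ((continuous_id.matrix_det).comp_continuousOn hAc).mono (Icc_subset_Ico_right ht.2)
  have h1 : (A t).det ≤ 0 := hle
  have h2 : (0 : ℝ) ≤ (A 0).det := by rw [hA0, Matrix.det_one]; exact zero_le_one
  obtain ⟨s, hs, hs0⟩ : ∃ s ∈ Icc 0 t, (A s).det = 0 :=
    intermediate_value_Icc' ht.1 hdc ⟨h1, h2⟩
  exact (hunit s ⟨hs.1, lt_of_le_of_lt hs.2 ht.2⟩).ne_zero hs0

/-- **The trace of the shape operator under Hessian initial data**: along a solution of
`𝒜'' + ℛ𝒜 = 0` on `(a, b) ∋ 0` with `ℛ` self-adjoint and `tr ℛ ≥ 0` on `[0, r)` (`r ≤ b`),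
`𝒜(0) = I`, `𝒜'(0)` self-adjoint with `tr 𝒜'(0) ≤ nκ` (`κ ≥ 0`), and `𝒜(t)` invertible on `[0, r)`,
the trace `ϕ = tr 𝒜'𝒜⁻¹` satisfies `ϕ(t) ≤ nκ/(1 + tκ)` for `t ∈ (0, r)`: `𝒰 = 𝒜'𝒜⁻¹` is
self-adjoint (Wronskian), `ϕ' ≤ −tr ℛ − tr 𝒰² ≤ −ϕ²/n`, and scalar Riccati comparison with the
model `κ/(1 + tκ)`. Brendle 2023, proof of Prop. 2.5. [cite: Brendle2022, Prop. 2.5 (proof)] -/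
theorem trace_shape_le_of_hessian [Nonempty ι] {A A' R : ℝ → Matrix ι ι ℝ} {a b r κ : ℝ}
    (h0 : (0 : ℝ) ∈ Ioo a b) (hrb : r ≤ b)
    (hA : ∀ t ∈ Ioo a b, HasDerivAt A (A' t) t)
    (hA' : ∀ t ∈ Ioo a b, HasDerivAt A' (-(R t * A t)) t)
    (hR : ∀ t ∈ Ioo a b, (R t).IsSymm) (hRic : ∀ t ∈ Ico 0 r, 0 ≤ (R t).trace)
    (hA0 : A 0 = 1) (hS0 : (A' 0).IsSymm) (hκ : 0 ≤ κ)
    (htr : (A' 0).trace ≤ Fintype.card ι * κ)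
    (hunit : ∀ t ∈ Ico 0 r, IsUnit (A t).det) :
    ∀ t ∈ Ioo 0 r, (A' t * (A t)⁻¹).trace ≤ Fintype.card ι * κ / (1 + t * κ) := by
  have hn : (0 : ℝ) < Fintype.card ι := by exact_mod_cast Fintype.card_pos
  have hsub : Ioo 0 r ⊆ Ioo a b := fun t ht ↦ ⟨h0.1.trans ht.1, lt_of_lt_of_le ht.2 hrb⟩
  have hsub' : Ico 0 r ⊆ Ioo a b := fun t ht ↦ ⟨lt_of_lt_of_le h0.1 ht.1, lt_of_lt_of_le ht.2 hrb⟩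
  -- the Wronskian and the symmetry of `𝒰`
  have hW := jacobi_wronskian_eq_zero_of_isSymm h0 hA hA' hR hA0 hS0
  have hUsymm : ∀ t ∈ Ico 0 r, (A' t * (A t)⁻¹).IsSymm := fun t ht ↦
    isSymm_mul_inv_of_wronskian_eq_zero (hW t (hsub' ht)) (hunit t ht)
  -- `ϕ` and its Riccati inequality
  set φ : ℝ → ℝ := fun t ↦ (A' t * (A t)⁻¹).trace with hφ
  set φ' : ℝ → ℝ := fun t ↦ -(R t).trace - ((A' t * (A t)⁻¹) * (A' t * (A t)⁻¹)).trace with hφ'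
  have hφd : ∀ t ∈ Ioo 0 r, HasDerivAt φ (φ' t) t := fun t ht ↦
    hasDerivAt_trace_shape (hA t (hsub ht)) (hA' t (hsub ht)) (hunit t ⟨ht.1.le, ht.2⟩)
  have hric : ∀ t ∈ Ioo 0 r, φ' t + φ t ^ 2 / Fintype.card ι ≤ 0 := by
    intro t ht
    have h := trace_shape_riccati_le (R := R t) (hUsymm t ⟨ht.1.le, ht.2⟩) (rfl : φ' t = _)
    have := hRic t ⟨ht.1.le, ht.2⟩
    change φ' t + φ t ^ 2 / Fintype.card ι + (R t).trace ≤ 0 at h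
    linarith
  -- the normalised trace `u = ϕ/n` is a subsolution of `u' + u² = 0`
  set u : ℝ → ℝ := fun t ↦ φ t / Fintype.card ι with hu
  set u' : ℝ → ℝ := fun t ↦ φ' t / Fintype.card ι with hu'
  have hud : ∀ t ∈ Ioo 0 r, HasDerivAt u (u' t) t := fun t ht ↦ (hφd t ht).div_const _
  have husub : ∀ t ∈ Ioo 0 r, u' t + u t ^ 2 + (fun _ ↦ (0 : ℝ)) t ≤ 0 := by
    intro t ht
    have h := hric t ht
    simp only [hu, hu', div_pow, add_zero]
    have e : φ' t / Fintype.card ι + φ t ^ 2 / (Fintype.card ι : ℝ) ^ 2 =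
        (φ' t + φ t ^ 2 / Fintype.card ι) / Fintype.card ι := by
      field_simp
    rw [e]
    exact div_nonpos_of_nonpos_of_nonneg h hn.le
  -- the model `H = κ/(1 + tκ)`
  set H : ℝ → ℝ := fun t ↦ κ * (1 + κ * t)⁻¹ with hH
  set H' : ℝ → ℝ := fun t ↦ κ * (-κ / (1 + κ * t) ^ 2) with hH'
  have hpos : ∀ t ∈ Ioo 0 r, 0 < 1 + κ * t := fun t ht ↦ by
    have := mul_nonneg hκ ht.1.le; linarith
  have hHd : ∀ t ∈ Ioo 0 r, HasDerivAt H (H' t) t := by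
    intro t ht
    have h1 : HasDerivAt (fun s ↦ 1 + κ * s) κ t := by
      simpa using ((hasDerivAt_id t).const_mul κ).const_add 1
    have h2 := (h1.inv (hpos t ht).ne').const_mul κ
    exact h2
  have hmodel : ∀ t ∈ Ioo 0 r, H' t + H t ^ 2 + (fun _ ↦ (0 : ℝ)) t = 0 := by
    intro t ht
    have hne := (hpos t ht).ne'
    simp only [hH, hH', add_zero]
    field_simp
    ring
  -- the initial comparison `limsup_{t↓0} (u - H) ≤ 0`: `u → tr 𝒜'(0)/n ≤ κ = H(0)`
  have hAc : ∀ t ∈ Ioo a b, ContinuousAt A t := fun t ht ↦ (hA t ht).continuousAt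
  have hA'c : ∀ t ∈ Ioo a b, ContinuousAt A' t := fun t ht ↦ (hA' t ht).continuousAt
  have hinv : Tendsto (fun t ↦ (A t)⁻¹) (𝓝 0) (𝓝 1) := by
    have hc : ContinuousAt Ring.inverse ((1 : (Matrix ι ι ℝ)ˣ) : Matrix ι ι ℝ) :=
      NormedRing.inverse_continuousAt 1
    rw [Units.val_one] at hc
    have hA0' : Tendsto A (𝓝 0) (𝓝 1) := by rw [← hA0]; exact (hAc 0 h0).tendsto
    have h2 := hc.tendsto.comp hA0'
    rw [Ring.inverse_one] at h2
    refine h2.congr (fun t ↦ ?_)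
    exact (Matrix.nonsing_inv_eq_ringInverse (A t)).symm
  have hU0 : Tendsto (fun t ↦ A' t * (A t)⁻¹) (𝓝 0) (𝓝 (A' 0)) := by
    have h := ((hA'c 0 h0).tendsto).mul hinv
    rwa [Matrix.mul_one] at h
  have hφ0 : Tendsto φ (𝓝 0) (𝓝 (A' 0).trace) := tendsto_matrix_trace hU0
  have hlim : ∀ ε > 0, ∀ᶠ t in 𝓝[>] (0 : ℝ), u t - H t < ε := by
    intro ε hε
    have h1 : Tendsto (fun t ↦ u t - H t) (𝓝 0) (𝓝 ((A' 0).trace / Fintype.card ι - κ)) := by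
      have hu0 : Tendsto u (𝓝 0) (𝓝 ((A' 0).trace / Fintype.card ι)) := hφ0.div_const _
      have hH0 : Tendsto H (𝓝 0) (𝓝 κ) := by
        have : ContinuousAt H 0 := by
          simp only [hH]
          refine (continuousAt_const.mul ((continuousAt_const.add
            (continuousAt_const.mul continuousAt_id)).inv₀ ?_))
          simp
        have h := this.tendsto
        simp only [hH, mul_zero, add_zero, inv_one, mul_one] at h
        exact h
      exact hu0.sub hH0
    have hle : (A' 0).trace / Fintype.card ι - κ ≤ 0 := by
      rw [sub_nonpos, div_le_iff₀ hn]
      linarith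
    have h2 : ∀ᶠ t in 𝓝 (0 : ℝ), u t - H t < ε :=
      h1.eventually (Iio_mem_nhds (lt_of_le_of_lt hle hε))
    exact nhdsWithin_le_nhds h2
  -- scalar Riccati comparison
  have hcomp := riccati_comparison (a := 0) (b := r) (S := fun _ ↦ (0 : ℝ)) (Sc := fun _ ↦ (0 : ℝ))
    (m := 0) hHd hud hmodel husub (fun _ _ ↦ le_rfl) (fun _ _ ↦ le_rfl) hlim
  intro t ht
  have h := hcomp t ht
  simp only [hu, hH] at h
  rw [div_le_iff₀ hn] at h
  have hne := (hpos t ht).ne'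
  calc (A' t * (A t)⁻¹).trace = φ t := rfl
    _ ≤ κ * (1 + κ * t)⁻¹ * Fintype.card ι := h
    _ = Fintype.card ι * κ / (1 + t * κ) := by rw [mul_comm t κ]; field_simp

/-- **Brendle's Jacobian monotonicity (Prop. 2.5).** Along a solution of the matrix Jacobi
equation `𝒜'' + ℛ𝒜 = 0` on `(a, b) ∋ 0` with `ℛ` self-adjoint and `tr ℛ ≥ 0` on `[0, r)`
(`Ric ≥ 0`), `𝒜(0) = I`, `𝒜'(0)` self-adjoint (`= D²u(x̄)`) with `tr 𝒜'(0) ≤ nκ`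
(`Δu(x̄) ≤ nκ`, `κ ≥ 0`), and `𝒜(t)` invertible for `t ∈ [0, r)` (no zeros of the Jacobi fields),
the function `t ↦ det 𝒜(t)/(1 + tκ)ⁿ` is non-increasing on `[0, r)` (`n = Fintype.card ι`):
`(log det 𝒜)' = tr 𝒜'𝒜⁻¹ ≤ nκ/(1 + tκ)` (`trace_shape_le_of_hessian`, Jacobi's formula).
[cite: Brendle2022, Prop. 2.5] -/
theorem antitoneOn_det_div_pow_of_hessian [Nonempty ι] {A A' R : ℝ → Matrix ι ι ℝ}
    {a b r κ : ℝ} (h0 : (0 : ℝ) ∈ Ioo a b) (hrb : r ≤ b)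
    (hA : ∀ t ∈ Ioo a b, HasDerivAt A (A' t) t)
    (hA' : ∀ t ∈ Ioo a b, HasDerivAt A' (-(R t * A t)) t)
    (hR : ∀ t ∈ Ioo a b, (R t).IsSymm) (hRic : ∀ t ∈ Ico 0 r, 0 ≤ (R t).trace)
    (hA0 : A 0 = 1) (hS0 : (A' 0).IsSymm) (hκ : 0 ≤ κ)
    (htr : (A' 0).trace ≤ Fintype.card ι * κ)
    (hunit : ∀ t ∈ Ico 0 r, IsUnit (A t).det) :
    AntitoneOn (fun t ↦ (A t).det / (1 + t * κ) ^ Fintype.card ι) (Ico 0 r) := by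
  have hn : (0 : ℝ) < Fintype.card ι := by exact_mod_cast Fintype.card_pos
  have hsub : Ioo 0 r ⊆ Ioo a b := fun t ht ↦ ⟨h0.1.trans ht.1, lt_of_lt_of_le ht.2 hrb⟩
  have hsub' : Ico 0 r ⊆ Ioo a b := fun t ht ↦ ⟨lt_of_lt_of_le h0.1 ht.1, lt_of_lt_of_le ht.2 hrb⟩
  have hAc : ContinuousOn A (Ico 0 r) := fun t ht ↦
    (hA t (hsub' ht)).continuousAt.continuousWithinAt
  have hdetpos := det_jacobi_pos_of_isUnit hAc hA0 hunit
  have hpos : ∀ t ∈ Ico 0 r, 0 < 1 + t * κ := fun t ht ↦ by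
    have := mul_nonneg ht.1 hκ; linarith
  have hφle := trace_shape_le_of_hessian h0 hrb hA hA' hR hRic hA0 hS0 hκ htr hunit
  -- `g = log det 𝒜 − n log (1 + tκ)` is non-increasing on `[0, r)`
  set g : ℝ → ℝ := fun t ↦ Real.log (A t).det - Fintype.card ι * Real.log (1 + t * κ) with hg
  have hgd : ∀ t ∈ Ioo 0 r, HasDerivAt g
      ((A' t * (A t)⁻¹).trace - Fintype.card ι * (κ / (1 + t * κ))) t := by
    intro t ht
    have ht' : t ∈ Ico 0 r := ⟨ht.1.le, ht.2⟩
    have hdet := hdetpos t ht'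
    have h1 := hasDerivAt_det_jacobi (hA t (hsub ht)) hdet.ne'
    have h2 : HasDerivAt (fun s ↦ Real.log (A s).det) ((A' t * (A t)⁻¹).trace) t := by
      have := h1.log hdet.ne'
      convert this using 1
      field_simp
    have h3 : HasDerivAt (fun s ↦ Real.log (1 + s * κ)) (κ / (1 + t * κ)) t := by
      have h4 : HasDerivAt (fun s ↦ 1 + s * κ) κ t := by
        simpa using ((hasDerivAt_id t).mul_const κ).const_add 1
      exact h4.log (hpos t ht').ne'
    exact h2.sub (h3.const_mul _)
  have hgc : ContinuousOn g (Ico 0 r) := by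
    intro t ht
    have h1 : ContinuousWithinAt (fun s ↦ Real.log (A s).det) (Ico 0 r) t :=
      ((continuous_id.matrix_det).continuousAt.comp_continuousWithinAt (hAc t ht)).log
        (hdetpos t ht).ne'
    have h2 : ContinuousWithinAt (fun s ↦ (Fintype.card ι : ℝ) * Real.log (1 + s * κ))
        (Ico 0 r) t := by
      refine (continuousWithinAt_const.mul ((continuousWithinAt_const.add
        (continuousWithinAt_id.mul continuousWithinAt_const)).log (hpos t ht).ne'))
    exact h1.sub h2
  have hanti : AntitoneOn g (Ico 0 r) := by
    refine antitoneOn_of_deriv_nonpos (convex_Ico 0 r) hgc ?_ ?_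
    · rw [interior_Ico]
      exact fun t ht ↦ (hgd t ht).differentiableAt.differentiableWithinAt
    · rw [interior_Ico]
      intro t ht
      rw [(hgd t ht).deriv, sub_nonpos]
      have h := hφle t ht
      calc (A' t * (A t)⁻¹).trace ≤ Fintype.card ι * κ / (1 + t * κ) := h
        _ = Fintype.card ι * (κ / (1 + t * κ)) := by rw [mul_div_assoc]
  -- back to `det 𝒜/(1 + tκ)ⁿ = exp g`
  have hexp : ∀ t ∈ Ico 0 r, (A t).det / (1 + t * κ) ^ Fintype.card ι = Real.exp (g t) := by
    intro t ht
    simp only [hg]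
    rw [Real.exp_sub, Real.exp_log (hdetpos t ht), ← Real.log_pow, Real.exp_log (pow_pos (hpos t ht) _)]
  intro s hs t ht hst
  show (A t).det / (1 + t * κ) ^ Fintype.card ι ≤ (A s).det / (1 + s * κ) ^ Fintype.card ι
  rw [hexp s hs, hexp t ht]
  exact Real.exp_le_exp.2 (hanti hs ht hst)

/-- **Brendle's Jacobian bound (Cor. 2.6): `det 𝒜(t) ≤ (1 + tκ)ⁿ` on `[0, r)`** under the
hypotheses of `antitoneOn_det_div_pow_of_hessian` (the value at `t = 0` is `det I = 1`). In the ABP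
argument this is `|det DΦ_t(x̄)| ≤ (1 + t f(x̄)^{1/(n−1)})ⁿ` for `x̄` in the contact set.
[cite: Brendle2022, Cor. 2.6] -/
theorem det_le_pow_of_hessian [Nonempty ι] {A A' R : ℝ → Matrix ι ι ℝ}
    {a b r κ : ℝ} (h0 : (0 : ℝ) ∈ Ioo a b) (hrb : r ≤ b)
    (hA : ∀ t ∈ Ioo a b, HasDerivAt A (A' t) t)
    (hA' : ∀ t ∈ Ioo a b, HasDerivAt A' (-(R t * A t)) t)
    (hR : ∀ t ∈ Ioo a b, (R t).IsSymm) (hRic : ∀ t ∈ Ico 0 r, 0 ≤ (R t).trace)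
    (hA0 : A 0 = 1) (hS0 : (A' 0).IsSymm) (hκ : 0 ≤ κ)
    (htr : (A' 0).trace ≤ Fintype.card ι * κ)
    (hunit : ∀ t ∈ Ico 0 r, IsUnit (A t).det) :
    ∀ t ∈ Ico 0 r, (A t).det ≤ (1 + t * κ) ^ Fintype.card ι := by
  intro t ht
  have hr : 0 < r := lt_of_le_of_lt ht.1 ht.2
  have h0r : (0 : ℝ) ∈ Ico 0 r := ⟨le_rfl, hr⟩
  have hmono := antitoneOn_det_div_pow_of_hessian h0 hrb hA hA' hR hRic hA0 hS0 hκ htr hunit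
    h0r ht ht.1
  have hpos : 0 < 1 + t * κ := by have := mul_nonneg ht.1 hκ; linarith
  simp only [zero_mul, add_zero, one_pow, div_one, hA0, Matrix.det_one] at hmono
  rwa [div_le_iff₀ (pow_pos hpos _), one_mul] at hmono

end ABPJacobian

end Literature.Geometry.Riemannian

end
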